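import Mathlib.MeasureTheory.Measure.Portmanteau
import Literature.Probability.RandomPlanarGeometry.LocalMartingaleProofs
import Literature.Probability.RandomPlanarGeometry.SeparatedTraces

/-!
# Curve upgrade, part 2: law convergence from range convergence plus an open-set transfer

Support file for the crux `HexConjecture` (stmt-CriticalPhenomena-0808, Duminil-Copin–Smirnov 2012
Conjecture 1), line `root-locality-replaces-loewner`, stub `stub_curveUpgrade` (ABSTRACT upgrade of
range convergence to curve convergence in `CurveClass ℂ`). Namespace `…RootLocality.Upgrade`.
This is the measure-theoretic PART 2 of the stub — the portmanteau glue, with NO tightness step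
(the mesh filter `𝓝[>] 0` is uncountable; cf. `MeshFilter.not_isTightAlongMesh_of_tendstoLaw`):

* `tendsto_real_univ_of_tendstoLaw`, `eventually_mass_mem` — `TendstoLaw` (portmanteau form of
  the tree, no probability hypotheses on the laws `P δ`) towards a probability law forces the
  total masses `P δ univ → 1` (test function `1`), so the laws are eventually finite with mass in
  `[1/2, 2]` and can be normalised;
* **`tendstoLaw_of_open_transfer`** — GENERIC UPGRADE: random elements `Y δ` (eventually
  a.e.-measurable) with values in a Borel space `S`, a continuous "shadow" `R : S → S'` into a
  metric Borel space, `TendstoLaw (R ∘ Y δ) P (R ∘ Z) P'` for a probability law `P'`, and the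
  OPEN-SET TRANSFER hypothesis — for every open `G ⊆ S` and `θ > 0` an open `O ⊆ S'` with
  `law(Z)(G) ≤ law(Z)(R ⁻¹ O) + θ` and eventually `P δ {R (Y δ) ∈ O} ≤ P δ {Y δ ∈ G} + θ` — give
  `TendstoLaw Y P Z P'`. Proof: normalise the laws to probability measures `ν δ`; the shadows
  `R_* ν δ` converge weakly (integrals of `g ∘ R`), so `law(R Z)(O) ≤ liminf R_* ν δ (O)`
  (portmanteau, open sets); the transfer turns this into `law(Z)(G) ≤ liminf ν δ (G) + 3θ`, hence
  `ν δ ⇒ law Z` (`tendsto_of_forall_isOpen_le_liminf'`, the filter being countably generated), and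
  un-normalising gives `TendstoLaw`;
* `tendstoLaw_curve_of_open_transfer` (registered helper, the case of the stub): `S = CurveClass ℂ`,
  `S' = NonemptyCompacts ℂ`, `R = range` (`1`-Lipschitz, `CurveClass.hausdorffDist_range_le_dist`),
  `P' = preWienerMeasure` (a probability measure, `isProbabilityMeasure_preWienerMeasure'`).

Folklore (Billingsley 1999, Thm 2.1 portmanteau; Mathlib `Portmanteau`); no named fact is used.
-/

noncomputable section

open MeasureTheory Filter Topology Set
open scoped ENNReal NNReal BoundedContinuousFunction

namespace Summit.CriticalPhenomena.SAWScalingLimit.Theorems.HexConjecture.RootLocality.Upgrade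

open Literature.Probability.RandomPlanarGeometry

section Generic

variable {Ωδ : ℝ → Type*} [∀ δ, MeasurableSpace (Ωδ δ)] {Ω' : Type*} [MeasurableSpace Ω']
  {S : Type*} [TopologicalSpace S]

/-- `TendstoLaw` towards a probability law forces the total masses to tend to `1` (test function
`1`). [folklore] -/
theorem tendsto_real_univ_of_tendstoLaw {Y : ∀ δ, Ωδ δ → S} {P : ∀ δ, Measure (Ωδ δ)} {Z : Ω' → S}
    {P' : Measure Ω'} [IsProbabilityMeasure P'] (h : TendstoLaw Y P Z P') :
    Tendsto (fun δ ↦ (P δ).real univ) (𝓝[>] (0 : ℝ)) (𝓝 1) := by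
  have h1 := h (BoundedContinuousFunction.const S 1)
  simpa [integral_const, probReal_univ] using h1

/-- If the total masses tend to `1`, the laws are eventually finite with mass in `[1/2, 2]`.
[folklore] -/
theorem eventually_mass_mem {P : ∀ δ, Measure (Ωδ δ)}
    (h : Tendsto (fun δ ↦ (P δ).real univ) (𝓝[>] (0 : ℝ)) (𝓝 1)) :
    ∀ᶠ δ in 𝓝[>] (0 : ℝ), IsFiniteMeasure (P δ) ∧ (2 : ℝ≥0∞)⁻¹ ≤ P δ univ ∧ P δ univ ≤ 2 := by
  have h1 : ∀ᶠ δ in 𝓝[>] (0 : ℝ), (1 / 2 : ℝ) < (P δ).real univ :=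
    h.eventually (lt_mem_nhds (by norm_num))
  have h2 : ∀ᶠ δ in 𝓝[>] (0 : ℝ), (P δ).real univ < 2 := h.eventually (gt_mem_nhds (by norm_num))
  filter_upwards [h1, h2] with δ hδ1 hδ2
  have hne : P δ univ ≠ ∞ := by
    intro htop
    have : (P δ).real univ = 0 := by simp [Measure.real, htop]
    linarith
  have hreal : (P δ).real univ = (P δ univ).toReal := rfl
  refine ⟨⟨hne.lt_top⟩, ?_, ?_⟩
  · rw [← ENNReal.ofReal_toReal hne, ← hreal,
      show (2 : ℝ≥0∞)⁻¹ = ENNReal.ofReal (1 / 2) by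
        rw [one_div, ENNReal.ofReal_inv_of_pos two_pos, ENNReal.ofReal_ofNat]]
    exact ENNReal.ofReal_le_ofReal hδ1.le
  · rw [← ENNReal.ofReal_toReal hne, ← hreal, show (2 : ℝ≥0∞) = ENNReal.ofReal 2 by simp]
    exact ENNReal.ofReal_le_ofReal hδ2.le

variable [MeasurableSpace S] [OpensMeasurableSpace S]
  {S' : Type*} [PseudoEMetricSpace S'] [MeasurableSpace S'] [BorelSpace S']

/-- **Generic upgrade of law convergence through a continuous shadow and an open-set transfer**
(see the module docstring): `TendstoLaw` of `R ∘ Y δ` to `R ∘ Z`, `P'` a probability law, `Z`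
a.e.-measurable, `Y δ` eventually a.e.-measurable, and for every open `G` and `θ > 0` an open `O`
with `law(Z)(G) ≤ law(Z)(R⁻¹ O) + θ` and eventually `P δ {R ∘ Y δ ∈ O} ≤ P δ {Y δ ∈ G} + θ`, imply
`TendstoLaw Y P Z P'`. [folklore] -/
theorem tendstoLaw_of_open_transfer {Y : ∀ δ, Ωδ δ → S} {P : ∀ δ, Measure (Ωδ δ)} {Z : Ω' → S}
    {P' : Measure Ω'} [IsProbabilityMeasure P'] (hZ : AEMeasurable Z P')
    (hY : ∀ᶠ δ in 𝓝[>] (0 : ℝ), AEMeasurable (Y δ) (P δ)) {R : S → S'} (hR : Continuous R)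
    (hlaw : TendstoLaw (fun δ ω ↦ R (Y δ ω)) P (fun ω ↦ R (Z ω)) P')
    (htrans : ∀ G : Set S, IsOpen G → ∀ θ : ℝ≥0∞, 0 < θ → ∃ O : Set S', IsOpen O ∧
      P'.map Z G ≤ P'.map Z (R ⁻¹' O) + θ ∧
      ∀ᶠ δ in 𝓝[>] (0 : ℝ), P δ (Y δ ⁻¹' (R ⁻¹' O)) ≤ P δ (Y δ ⁻¹' G) + θ) :
    TendstoLaw Y P Z P' := by
  classical
  have hRm : Measurable R := hR.measurable
  -- Step 1: total masses
  have hmass := tendsto_real_univ_of_tendstoLaw hlaw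
  -- the limit law as a probability measure
  set μ : Measure S := P'.map Z with hμ
  haveI hμprob : IsProbabilityMeasure μ := Measure.isProbabilityMeasure_map hZ
  let μP : ProbabilityMeasure S := ⟨μ, hμprob⟩
  have hμP : (μP : Measure S) = μ := rfl
  -- Step 2: the normalised laws
  let good : ℝ → Prop := fun δ ↦
    IsFiniteMeasure (P δ) ∧ (2 : ℝ≥0∞)⁻¹ ≤ P δ univ ∧ P δ univ ≤ 2 ∧ AEMeasurable (Y δ) (P δ)
  have hgood : ∀ᶠ δ in 𝓝[>] (0 : ℝ), good δ := by
    filter_upwards [eventually_mass_mem hmass, hY] with δ h1 h2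
    exact ⟨h1.1, h1.2.1, h1.2.2, h2⟩
  have hm0 : ∀ δ, good δ → P δ univ ≠ 0 := fun δ h h0 ↦ by
    have := h.2.1; rw [h0] at this; simp at this
  have hmt : ∀ δ, good δ → P δ univ ≠ ∞ := fun δ h ↦ by
    haveI := h.1; exact measure_ne_top _ _
  have hprob : ∀ δ, good δ → IsProbabilityMeasure ((P δ univ)⁻¹ • (P δ).map (Y δ)) := by
    intro δ h
    refine ⟨?_⟩
    rw [Measure.smul_apply, Measure.map_apply_of_aemeasurable h.2.2.2 MeasurableSet.univ,
      preimage_univ, smul_eq_mul, ENNReal.inv_mul_cancel (hm0 δ h) (hmt δ h)]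
  let ν : ℝ → ProbabilityMeasure S := fun δ ↦
    if h : good δ then ⟨(P δ univ)⁻¹ • (P δ).map (Y δ), hprob δ h⟩ else μP
  have hν : ∀ δ, good δ → (ν δ : Measure S) = (P δ univ)⁻¹ • (P δ).map (Y δ) := fun δ h ↦ by
    simp only [ν, dif_pos h, ProbabilityMeasure.coe_mk]
  have hνapply : ∀ δ, good δ → ∀ A : Set S, MeasurableSet A →
      (ν δ : Measure S) A = (P δ univ)⁻¹ * P δ (Y δ ⁻¹' A) := fun δ h A hA ↦ by
    rw [hν δ h, Measure.smul_apply, Measure.map_apply_of_aemeasurable h.2.2.2 hA, smul_eq_mul]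
  have hνint : ∀ δ, good δ → ∀ f : S →ᵇ ℝ,
      ∫ x, f x ∂(ν δ : Measure S) = ((P δ univ)⁻¹).toReal * ∫ ω, f (Y δ ω) ∂P δ := fun δ h f ↦ by
    rw [hν δ h, integral_smul_measure, integral_map h.2.2.2 f.continuous.aestronglyMeasurable,
      smul_eq_mul]
  have hinvreal : Tendsto (fun δ ↦ ((P δ univ)⁻¹).toReal) (𝓝[>] (0 : ℝ)) (𝓝 1) := by
    have h := hmass.inv₀ one_ne_zero
    rw [inv_one] at h
    refine h.congr' (Eventually.of_forall fun δ ↦ ?_)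
    show ((P δ).real univ)⁻¹ = ((P δ univ)⁻¹).toReal
    rw [ENNReal.toReal_inv]
    rfl
  -- Step 3: the shadows of the normalised laws converge weakly
  let ν' : ℝ → ProbabilityMeasure S' := fun δ ↦ (ν δ).map hRm.aemeasurable
  let μP' : ProbabilityMeasure S' := μP.map hRm.aemeasurable
  have hν'apply : ∀ δ (O : Set S'), MeasurableSet O →
      (ν' δ : Measure S') O = (ν δ : Measure S) (R ⁻¹' O) := fun δ O hO ↦ by
    rw [ProbabilityMeasure.toMeasure_map, Measure.map_apply hRm hO]
  have hμP'apply : ∀ O : Set S', MeasurableSet O → (μP' : Measure S') O = μ (R ⁻¹' O) :=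
    fun O hO ↦ by
    rw [ProbabilityMeasure.toMeasure_map, Measure.map_apply hRm hO, hμP]
  have hconv' : Tendsto ν' (𝓝[>] (0 : ℝ)) (𝓝 μP') := by
    rw [ProbabilityMeasure.tendsto_iff_forall_integral_tendsto]
    intro g
    let gR : S →ᵇ ℝ := g.compContinuous ⟨R, hR⟩
    have lhs : ∀ δ, ∫ x, g x ∂(ν' δ : Measure S') = ∫ x, gR x ∂(ν δ : Measure S) := fun δ ↦ by
      rw [ProbabilityMeasure.toMeasure_map]
      exact integral_map hRm.aemeasurable g.continuous.aestronglyMeasurable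
    have rhs : ∫ x, g x ∂(μP' : Measure S') = ∫ ω, g (R (Z ω)) ∂P' := by
      rw [ProbabilityMeasure.toMeasure_map, integral_map hRm.aemeasurable
        g.continuous.aestronglyMeasurable, hμP, hμ]
      exact integral_map hZ (show AEStronglyMeasurable (fun x ↦ g (R x)) (Measure.map Z P') from
        (g.continuous.comp hR).aestronglyMeasurable)
    simp_rw [lhs, rhs]
    have hev : (fun δ ↦ ((P δ univ)⁻¹).toReal * ∫ ω, gR (Y δ ω) ∂P δ) =ᶠ[𝓝[>] (0 : ℝ)]
        fun δ ↦ ∫ x, g (R x) ∂(ν δ : Measure S) := by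
      filter_upwards [hgood] with δ hδ
      exact (hνint δ hδ gR).symm
    refine Tendsto.congr' hev ?_
    have h2 := hlaw g
    have h3 := hinvreal.mul h2
    rw [one_mul] at h3
    exact h3
  -- Step 4: the open-set liminf inequality for the normalised laws
  have hopen : ∀ G : Set S, IsOpen G →
      (μP : Measure S) G ≤ liminf (fun δ ↦ (ν δ : Measure S) G) (𝓝[>] (0 : ℝ)) := by
    intro G hG
    rw [hμP]
    refine ENNReal.le_of_forall_pos_le_add fun ε hε _ ↦ ?_
    set θ : ℝ≥0∞ := (ε : ℝ≥0∞) / 3 with hθ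
    have hθpos : 0 < θ := ENNReal.div_pos (by simpa using hε.ne') (by norm_num)
    have hθtop : θ ≠ ∞ := ENNReal.div_ne_top ENNReal.coe_ne_top (by norm_num)
    obtain ⟨O, hO, hμO, hev⟩ := htrans G hG θ hθpos
    have hport : (μP' : Measure S') O ≤ liminf (fun δ ↦ (ν' δ : Measure S') O) (𝓝[>] (0 : ℝ)) :=
      ProbabilityMeasure.le_liminf_measure_open_of_tendsto hconv' hO
    rw [hμP'apply O hO.measurableSet] at hport
    simp_rw [hν'apply _ O hO.measurableSet] at hport
    -- eventually `ν δ (R⁻¹ O) ≤ ν δ G + 2 θ`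
    have hevν : ∀ᶠ δ in 𝓝[>] (0 : ℝ),
        (ν δ : Measure S) (R ⁻¹' O) ≤ (ν δ : Measure S) G + 2 * θ := by
      filter_upwards [hgood, hev] with δ hδ hδ'
      rw [hνapply δ hδ _ (hO.preimage hR).measurableSet, hνapply δ hδ G hG.measurableSet]
      have hinv2 : (P δ univ)⁻¹ ≤ 2 := by
        have := ENNReal.inv_le_inv.2 hδ.2.1
        rwa [inv_inv] at this
      calc (P δ univ)⁻¹ * P δ (Y δ ⁻¹' (R ⁻¹' O))
          ≤ (P δ univ)⁻¹ * (P δ (Y δ ⁻¹' G) + θ) := by gcongr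
        _ = (P δ univ)⁻¹ * P δ (Y δ ⁻¹' G) + (P δ univ)⁻¹ * θ := mul_add _ _ _
        _ ≤ (P δ univ)⁻¹ * P δ (Y δ ⁻¹' G) + 2 * θ := by gcongr
    have hlim : liminf (fun δ ↦ (ν δ : Measure S) (R ⁻¹' O)) (𝓝[>] (0 : ℝ)) ≤
        liminf (fun δ ↦ (ν δ : Measure S) G + 2 * θ) (𝓝[>] (0 : ℝ)) :=
      liminf_le_liminf hevν
    rw [liminf_add_const (𝓝[>] (0 : ℝ)) _ (2 * θ) (by isBoundedDefault) (by isBoundedDefault)]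
      at hlim
    calc μ G ≤ μ (R ⁻¹' O) + θ := hμO
      _ ≤ liminf (fun δ ↦ (ν δ : Measure S) G) (𝓝[>] (0 : ℝ)) + 2 * θ + θ :=
          add_le_add (hport.trans hlim) le_rfl
      _ = liminf (fun δ ↦ (ν δ : Measure S) G) (𝓝[>] (0 : ℝ)) + ε := by
          rw [hθ, add_assoc, two_mul, ENNReal.add_thirds]
  -- Step 5: weak convergence of the normalised laws and un-normalisation
  have hconv : Tendsto ν (𝓝[>] (0 : ℝ)) (𝓝 μP) := tendsto_of_forall_isOpen_le_liminf' hopen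
  intro f
  have h1 := (ProbabilityMeasure.tendsto_iff_forall_integral_tendsto.1 hconv) f
  rw [hμP, hμ, integral_map hZ f.continuous.aestronglyMeasurable] at h1
  have hreal : ∀ δ, (P δ).real univ = (P δ univ).toReal := fun δ ↦ rfl
  have hev : (fun δ ↦ (P δ).real univ * ∫ x, f x ∂(ν δ : Measure S)) =ᶠ[𝓝[>] (0 : ℝ)]
      fun δ ↦ ∫ ω, f (Y δ ω) ∂P δ := by
    filter_upwards [hgood] with δ hδ
    rw [hνint δ hδ f, ← mul_assoc, hreal, ENNReal.toReal_inv, mul_inv_cancel₀, one_mul]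
    exact ENNReal.toReal_ne_zero.2 ⟨hm0 δ hδ, hmt δ hδ⟩
  refine Tendsto.congr' hev ?_
  have h3 := hmass.mul h1
  rw [one_mul] at h3
  exact h3

end Generic

/-- **PART 2 of `stub_curveUpgrade` (registered helper): curve convergence from range convergence
plus an open-set transfer.** Random curve classes `X δ : Ω δ → CurveClass ℂ` under laws `P δ`
(eventually a.e.-measurable), an a.e.-measurable `Γ` on the canonical space, `TendstoLaw` of the
RANGES (in the hyperspace `NonemptyCompacts ℂ`, Hausdorff metric) to the range of `Γ` under the
pre-Wiener measure, and the transfer hypothesis — for every open `G ⊆ CurveClass ℂ` and `θ > 0`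
an open set `O` of compacts with `law(Γ)(G) ≤ law(Γ){range ∈ O} + θ` and eventually
`P δ {range (X δ) ∈ O} ≤ P δ {X δ ∈ G} + θ` — give `TendstoLaw X P Γ preWienerMeasure`.
(`tendstoLaw_of_open_transfer` with the `1`-Lipschitz range map.) [folklore] -/
theorem tendstoLaw_curve_of_open_transfer : ∀ (Ω : ℝ → Type) [∀ δ, MeasurableSpace (Ω δ)] (X : ∀ δ, Ω δ → Literature.Probability.RandomPlanarGeometry.CurveClass ℂ) (P : ∀ δ, MeasureTheory.Measure (Ω δ)) (Γ : (NNReal → ℝ) → Literature.Probability.RandomPlanarGeometry.CurveClass ℂ), AEMeasurable Γ Literature.Probability.Process.preWienerMeasure → (∀ᶠ δ : ℝ in nhdsWithin (0 : ℝ) (Set.Ioi 0), AEMeasurable (X δ) (P δ)) → Literature.Probability.RandomPlanarGeometry.TendstoLaw (fun δ ω => (⟨⟨(X δ ω).range, (X δ ω).isCompact_range⟩, (X δ ω).range_nonempty⟩ : TopologicalSpace.NonemptyCompacts ℂ)) P (fun ω => (⟨⟨(Γ ω).range, (Γ ω).isCompact_range⟩, (Γ ω).range_nonempty⟩ : TopologicalSpace.NonemptyCompacts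 ℂ)) Literature.Probability.Process.preWienerMeasure → (∀ G : Set (Literature.Probability.RandomPlanarGeometry.CurveClass ℂ), IsOpen G → ∀ θ : ENNReal, 0 < θ → ∃ O : Set (TopologicalSpace.NonemptyCompacts ℂ), IsOpen O ∧ Literature.Probability.Process.preWienerMeasure.map Γ G ≤ Literature.Probability.Process.preWienerMeasure.map Γ {γ | (⟨⟨γ.range, γ.isCompact_range⟩, γ.range_nonempty⟩ : TopologicalSpace.NonemptyCompacts ℂ) ∈ O} + θ ∧ ∀ᶠ δ : ℝ in nhdsWithin (0 : ℝ) (Set.Ioi 0), P δ {ω | (⟨⟨(X δ ω).range, (X δ ω).isCompact_range⟩, (X δ ω).range_nonempty⟩ : TopologicalSpace.NonemptyCompacts ℂ) ∈ O} ≤ P δ (X δ ⁻¹' G) + θ) → Literature.Probability.RandomPlanarGeometry.TendstoLaw X P Γ Literature.Probability.Process.preWienerMeasure := by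
  intro Ω _ X P Γ hΓ hX hlaw htrans
  letI : MeasurableSpace (TopologicalSpace.NonemptyCompacts ℂ) := borel _
  haveI : BorelSpace (TopologicalSpace.NonemptyCompacts ℂ) := ⟨rfl⟩
  haveI : IsProbabilityMeasure Literature.Probability.Process.preWienerMeasure :=
    isProbabilityMeasure_preWienerMeasure'
  set R : CurveClass ℂ → TopologicalSpace.NonemptyCompacts ℂ :=
    fun γ ↦ ⟨⟨γ.range, γ.isCompact_range⟩, γ.range_nonempty⟩ with hR
  have hRc : Continuous R := by
    refine (LipschitzWith.mk_one fun c c' ↦ ?_).continuous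
    rw [Metric.NonemptyCompacts.dist_eq]
    exact CurveClass.hausdorffDist_range_le_dist c c'
  exact tendstoLaw_of_open_transfer (R := R) hΓ hX hRc hlaw fun G hG θ hθ ↦ htrans G hG θ hθ

end Summit.CriticalPhenomena.SAWScalingLimit.Theorems.HexConjecture.RootLocality.Upgrade
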